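import Summits.CriticalPhenomena.PercolationContinuityZ3.Theorems.FK.InfiniteVolumeMonotone
import Summits.CriticalPhenomena.PercolationContinuityZ3.Theorems.FK.InfiniteVolumeDLR
import Summits.CriticalPhenomena.PercolationContinuityZ3.Theorems.FK.DomainMarkovExtremalityLimits
import Summits.CriticalPhenomena.PercolationContinuityZ3.Theorems.FK.ThetaIdentificationCanonical
import Summits.CriticalPhenomena.PercolationContinuityZ3.Theorems.Transplant.FKUniqueAtCriticalOfRaoufi
import Literature.Probability.LatticeModels.RandomClusterEdgeDensities
import HarnessLib

/-!
# FK-continuity cell, FO-07b: the free and wired infinite-volume random-cluster measures on `ℤ^d`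
# coincide off a countable set of `p` — Grimmett 2006, Thm. (4.63) with Thm. (4.60), at measure level

Helper file of the `fk-continuity` build cell (bschramm lane; `--supports stmt-CriticalPhenomena-4575`),
row FO-07b (registered under R42(8) in `run/shared/lean/prim/bschramm/fk-continuity/INBOX.md`); builds on
p205010 (kernel theorem, internal audit signed; external expert review pending).
No definitions, no named facts, no sorries; standard axioms.

Grimmett 2006, Thm. (4.63), p. 89 (with Thm. (4.60)): for `q ≥ 1` there is a countable set `𝒟_q` of
parameters such that for `p ∉ 𝒟_q` the free and wired edge densities agree, `h⁰(p,q) = h¹(p,q)`,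
EQUIVALENTLY the infinite-volume measures agree, `φ⁰_{p,q} = φ¹_{p,q}`, and then there is exactly one
random-cluster measure (`|W_{p,q}| = |R_{p,q}| = 1`). The tree holds the finite-volume half of this in
`Literature/Probability/LatticeModels/RandomClusterEdgeDensities.lean` (written before the cell's
infinite-volume measures existed): `countable_setOf_freeEdgeDensity_lt` (the set of `p` with
`h⁰(p,q) < h¹(p,q)` is countable — (4.60) without the pressure) and
`iInf_boxWiredReal_le_iSup_boxFreeReal` (at a `p` with `h⁰ = h¹`, `inf_k φ¹_{Λ_{m+k}}(A) ≤ sup_k φ⁰_{Λ_{m+k}}(A)`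
for increasing box events — (4.63) (c) ⇒ (d) via Prop. (4.6) "in the tree's finite-volume language").
This file closes the statement over the cell's infinite-volume measures
`rcLimit d b p q` (`InfiniteVolumeDefs.lean` / `InfiniteVolumeMeasures.lean`, Grimmett's `φ^b_{p,q}`,
Thm. (4.19)(a)):

* `rcLimit_true_real_le_rcLimit_false_real_of_edgeDensity_eq` — at a `p` with `h⁰ = h¹`,
  `φ¹_{p,q}(A) ≤ φ⁰_{p,q}(A)` for every increasing local event `A`;
* `rcLimit_false_eq_rcLimit_true_of_edgeDensity_eq`, `edgeDensity_eq_of_rcLimit_false_eq_rcLimit_true`,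
  `rcLimit_false_eq_rcLimit_true_iff` — **Thm. (4.63): `φ⁰_{p,q} = φ¹_{p,q}` (as measures) iff
  `h⁰(p,q) = h¹(p,q)`** (`p ∈ [0,1]`, `q ≥ 1`, every `d`);
* `countable_setOf_rcLimit_false_ne_rcLimit_true` — **Thm. (4.60)/(4.63): the set
  `{p ∈ [0,1] : φ⁰_{p,q} ≠ φ¹_{p,q}}` is countable** (`q ≥ 1`, every `d`);
* `FKGibbs.eq_rcLimit_of_edgeDensity_eq`, `fkGibbs_iff_eq_rcLimit_of_edgeDensity_eq`,
  `countable_setOf_exists_fkGibbs_ne_rcLimit` — off that countable set the cell's sandwich class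
  `FKGibbs d p q` is the singleton `{φ⁰_{p,q}}` (Grimmett's `|W_{p,q}| = |R_{p,q}| = 1` read on the class;
  the class-level step is fkp-10a's `FKGibbs.eq_rcLimit_of_rcLimit_false_eq_true`, (4.36) "⇐", whose
  hypothesis is discharged here);
* `thetaFree_eq_thetaWired_of_rcLimit_false_eq_rcLimit_true`, `countable_setOf_thetaFree_ne_thetaWired` —
  §5.1, p. 98: "`θ⁰(p,q) = θ¹(p,q)` for almost every `p`" in the sharper printed form "except possibly for
  countably many `p`" (the θ-identification is FO-07's `rcLimit_false/true_real_percolatesAt`); in the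
  cell's seam vocabulary (`FK.FKUniqueAt d p q := θ⁰(p,q) = θ¹(p,q)`, `Transplant/FKUniqueAtCriticalOfRaoufi`):
  `fkUniqueAt_of_rcLimit_false_eq_rcLimit_true`, `countable_setOf_not_fkUniqueAt` — **the boundary-condition
  seam fails for at most countably many `p`**.

Not restated (imported by name): the edge-density machinery (LM `RandomClusterEdgeDensities`,
`RandomClusterShiftedBoxes`), the box-law bounds `rcLimit_real_le_rcBoxLaw` / `rcBoxLaw_real_le_rcLimit`
(FO-06b `InfiniteVolumeMonotone`), `rcLimit_real_false_le_true` and the one-edge marginals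
`IsBoxLimit.real_setOf_mem_eq_free/wiredEdgeDensity` (`InfiniteVolumeMeasures`), `ext_of_setOf_subset`
(`InfiniteVolumeCylinders`), `IsBoxLimit.fkGibbs` (FO-06a `InfiniteVolumeDLR`).

HONEST FRAMING: banked GRC ch. 4–5 structure for prim-sahi / fk-ref FO-17; not an END-STATE dependency of
the cell; it says nothing about whether `p_c(q)` lies in the exceptional set `𝒟_q`, i.e. nothing about
FH / TP_FK / continuity of `θ` at `p_c(q)` (for `q > Q(d)` the tree proves `p_c(q) ∈ 𝒟_q`,
`RandomClusterFirstOrderNarrow_holds`; for `q ∈ (1, Q(d)]` in `d ≥ 3` the question is open).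

## References

* G. Grimmett, *The Random-Cluster Model*, Springer 2006 (`book:grimmett2006-random-cluster-model`):
  Prop. (4.6), Thm. (4.19)(a), Thm. (4.34) eq. (4.36), Thm. (4.60) [PDF p. 88], (4.61), Thm. (4.63)
  [PDF p. 89] with its proof (4.73)–(4.77) [PDF p. 92], §5.1 (5.1)–(5.4) and the sentence "By Theorem 4.63,
  `φ⁰_{p,q} = φ¹_{p,q}` for almost every `p` … hence `p_c⁰(q) = p_c¹(q)`" [PDF p. 99], Thm. (5.16)(c)
  [PDF p. 101]. [Grimmett2006]
-/

noncomputable section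

open MeasureTheory Set Filter
open scoped Topology ENNReal

namespace Summit.CriticalPhenomena.PercolationContinuityZ3.Theorems.FK

open Literature.Probability.Percolation Literature.Probability.LatticeModels
open Literature.Barriers.CriticalPhenomena

variable {d : ℕ}

/-! ### The box laws of an event determined inside `Λ_m`, read in the Literature's `boxWiredReal` / `boxFreeReal` -/

/-- For an event `A` determined by pairs inside `Λ_m`, the wired box law of `Λ_{m+k}` on `A` is the
Literature's `boxWiredReal d p q m (pull-back of A to Λ_m) k = φ¹_{Λ_{m+k}}(A)`. [cite: Grimmett2006, Thm. (4.19)(a)] -/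
theorem rcBoxLaw_true_real_eq_boxWiredReal (p q : ℝ) {A : Set (BondConfig (Site d))}
    {F : Finset (Sym2 (Site d))} (hA : DeterminedBy A ↑F) (hAm : MeasurableSet A) {m : ℕ}
    (hF : ∀ e ∈ F, ∀ z ∈ e, z ∈ box d m) (k : ℕ) :
    (rcBoxLaw d true p q (m + k)).real A = boxWiredReal d p q m (liftEdges (box d m) ⁻¹' A) k := by
  rw [rcBoxLaw_real_apply _ _ _ _ hAm, rcBoxMeasure_true, boxWiredReal,
    finsetRestrict_preimage_liftEdges_preimage hA hF (Nat.le_add_right m k)]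

/-- For an event `A` determined by pairs inside `Λ_m`, the free box law of `Λ_{m+k}` on `A` is the
Literature's `boxFreeReal d p q m (pull-back of A to Λ_m) k = φ⁰_{Λ_{m+k}}(A)`. [cite: Grimmett2006, Thm. (4.19)(a)] -/
theorem rcBoxLaw_false_real_eq_boxFreeReal (p q : ℝ) {A : Set (BondConfig (Site d))}
    {F : Finset (Sym2 (Site d))} (hA : DeterminedBy A ↑F) (hAm : MeasurableSet A) {m : ℕ}
    (hF : ∀ e ∈ F, ∀ z ∈ e, z ∈ box d m) (k : ℕ) :
    (rcBoxLaw d false p q (m + k)).real A = boxFreeReal d p q m (liftEdges (box d m) ⁻¹' A) k := by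
  rw [rcBoxLaw_real_apply _ _ _ _ hAm, rcBoxMeasure_false, boxFreeReal,
    finsetRestrict_preimage_liftEdges_preimage hA hF (Nat.le_add_right m k)]

/-! ### Thm. (4.63): at a parameter of equal edge densities, `φ¹_{p,q} ≤ φ⁰_{p,q}` on increasing local events -/

/-- **Grimmett 2006, Thm. (4.63) (c) ⇒ (d), infinite-volume form**: at a parameter `p` with
`h⁰(p,q) = h¹(p,q)` (all edges; `d ≥ 1`, `0 ≤ p ≤ 1`, `q ≥ 1`), `φ¹_{p,q}(A) ≤ φ⁰_{p,q}(A)` for every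
increasing local event `A`: squeeze `φ¹_{p,q}(A) ≤ inf_k φ¹_{Λ_{m+k}}(A) ≤ sup_k φ⁰_{Λ_{m+k}}(A) ≤ φ⁰_{p,q}(A)`
(`Λ_m` a box containing the pairs determining `A`; middle step = the Literature's finite-volume
(c) ⇒ (d)). [cite: Grimmett2006, Thm. (4.63) ((c) ⇒ (d)) with Prop. (4.6) and Thm. (4.19)(a)] -/
theorem rcLimit_true_real_le_rcLimit_false_real_of_edgeDensity_eq (hd : 0 < d) {p q : ℝ}
    (hp : p ∈ Set.Icc (0 : ℝ) 1) (hq : 1 ≤ q)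
    (hgood : ∀ e ∈ (zdGraph d).edgeSet, freeEdgeDensity d p q e = wiredEdgeDensity d p q e)
    {A : Set (BondConfig (Site d))} {F : Finset (Sym2 (Site d))} (hA : DeterminedBy A ↑F)
    (hAu : IsUpperSet A) : (rcLimit d true p q).real A ≤ (rcLimit d false p q).real A := by
  have hAl : IsLocalEvent A := ⟨F, hA⟩
  have hAm : MeasurableSet A := measurableSet_of_isLocalEvent_holds hAl
  have hF : ∀ e ∈ F, ∀ z ∈ e, z ∈ box d (F.sup pairRad) := forall_mem_box_of_sup_pairRad_le le_rfl
  have hA' : IsUpperSet (liftEdges (box d (F.sup pairRad)) ⁻¹' A) := hAu.preimage (liftEdges_mono _)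
  calc (rcLimit d true p q).real A
      ≤ ⨅ k : ℕ, boxWiredReal d p q (F.sup pairRad) (liftEdges (box d (F.sup pairRad)) ⁻¹' A) k := by
        refine le_ciInf fun k => ?_
        rw [← rcBoxLaw_true_real_eq_boxWiredReal p q hA hAm hF k]
        exact rcLimit_real_le_rcBoxLaw hd hp hq hA hAu
          fun e he z hz => box_mono d (Nat.le_add_right _ k) (hF e he z hz)
    _ ≤ ⨆ k : ℕ, boxFreeReal d p q (F.sup pairRad) (liftEdges (box d (F.sup pairRad)) ⁻¹' A) k :=
        iInf_boxWiredReal_le_iSup_boxFreeReal hd hp hq hgood _ hA'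
    _ ≤ (rcLimit d false p q).real A := by
        refine ciSup_le fun k => ?_
        rw [← rcBoxLaw_false_real_eq_boxFreeReal p q hA hAm hF k]
        exact rcBoxLaw_real_le_rcLimit hp hq hAl hAu _

/-- At a parameter of equal edge densities the free and wired measures AGREE on every increasing local
event (`d ≥ 1`, `0 ≤ p ≤ 1`, `q ≥ 1`). [cite: Grimmett2006, Thm. (4.63) ((c) ⇒ (d)) with Lemma (4.14)(b)] -/
theorem rcLimit_false_real_eq_rcLimit_true_real_of_edgeDensity_eq (hd : 0 < d) {p q : ℝ}
    (hp : p ∈ Set.Icc (0 : ℝ) 1) (hq : 1 ≤ q)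
    (hgood : ∀ e ∈ (zdGraph d).edgeSet, freeEdgeDensity d p q e = wiredEdgeDensity d p q e)
    {A : Set (BondConfig (Site d))} {F : Finset (Sym2 (Site d))} (hA : DeterminedBy A ↑F)
    (hAu : IsUpperSet A) : (rcLimit d false p q).real A = (rcLimit d true p q).real A :=
  le_antisymm (rcLimit_real_false_le_true hp hq ⟨F, hA⟩ hAu)
    (rcLimit_true_real_le_rcLimit_false_real_of_edgeDensity_eq hd hp hq hgood hA hAu)

/-! ### Thm. (4.63): `φ⁰_{p,q} = φ¹_{p,q}` iff `h⁰(p,q) = h¹(p,q)` -/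

/-- **Grimmett 2006, Thm. (4.63), (c) ⇒ (a) as an equality of measures**: if the free and wired edge
densities agree at `p` (`0 ≤ p ≤ 1`, `q ≥ 1`; every `d` — in dimension `0` both sides are trivial), then
`φ⁰_{p,q} = φ¹_{p,q}`. Proof: the two probability measures agree on the increasing cylinders `{E₀ ⊆ ω}`,
which determine a probability measure. [cite: Grimmett2006, Thm. (4.63) with Prop. (4.6) and Thm. (4.19)(a)] -/
theorem rcLimit_false_eq_rcLimit_true_of_edgeDensity_eq {p q : ℝ} (hp : p ∈ Set.Icc (0 : ℝ) 1)
    (hq : 1 ≤ q)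
    (hgood : ∀ e ∈ (zdGraph d).edgeSet, freeEdgeDensity d p q e = wiredEdgeDensity d p q e) :
    rcLimit d false p q = rcLimit d true p q := by
  rcases Nat.eq_zero_or_pos d with hd | hd
  · exact (rcLimit_eq_false_of_eq_zero hd true p q).symm
  haveI := isProbabilityMeasure_rcLimit false p q (d := d)
  haveI := isProbabilityMeasure_rcLimit true p q (d := d)
  refine ext_of_setOf_subset fun E₀ => ?_
  have hAu : IsUpperSet {ω : BondConfig (Site d) | (↑E₀ : Set (Sym2 (Site d))) ⊆ ω} :=
    fun ω ω' hle hω => Set.Subset.trans hω hle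
  have h := rcLimit_false_real_eq_rcLimit_true_real_of_edgeDensity_eq hd hp hq hgood
    (determinedBy_setOf_subset E₀) hAu
  exact (ENNReal.toReal_eq_toReal_iff' (measure_ne_top _ _) (measure_ne_top _ _)).1 h

/-- **Thm. (4.63), (a) ⇒ (c)**: if `φ⁰_{p,q} = φ¹_{p,q}` then the edge densities agree, `h⁰(p,q) = h¹(p,q)`
(one-edge marginals of the limits are the densities, (4.61)). [cite: Grimmett2006, Thm. (4.63) with (4.61)] -/
theorem edgeDensity_eq_of_rcLimit_false_eq_rcLimit_true {p q : ℝ} (hp : p ∈ Set.Icc (0 : ℝ) 1)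
    (hq : 1 ≤ q) (h : rcLimit d false p q = rcLimit d true p q) {e : Sym2 (Site d)}
    (he : e ∈ (zdGraph d).edgeSet) : freeEdgeDensity d p q e = wiredEdgeDensity d p q e := by
  obtain ⟨i, -, -⟩ := exists_eq_map_add_of_mem_edgeSet he
  have hd : 0 < d := i.pos
  rw [← (isBoxLimit_rcLimit false hp hq).real_setOf_mem_eq_freeEdgeDensity hp hq e,
    ← (isBoxLimit_rcLimit true hp hq).real_setOf_mem_eq_wiredEdgeDensity hd hp hq e, h]

/-- **Grimmett 2006, Thm. (4.63)** for the random-cluster model on `ℤ^d` (`0 ≤ p ≤ 1`, `q ≥ 1`, every `d`):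
`φ⁰_{p,q} = φ¹_{p,q}` **iff** `h⁰(p,q)(e) = h¹(p,q)(e)` for every edge `e` (by (4.61) one edge suffices).
[cite: Grimmett2006, Thm. (4.63)] -/
theorem rcLimit_false_eq_rcLimit_true_iff {p q : ℝ} (hp : p ∈ Set.Icc (0 : ℝ) 1) (hq : 1 ≤ q) :
    rcLimit d false p q = rcLimit d true p q ↔
      ∀ e ∈ (zdGraph d).edgeSet, freeEdgeDensity d p q e = wiredEdgeDensity d p q e :=
  ⟨fun h _ he => edgeDensity_eq_of_rcLimit_false_eq_rcLimit_true hp hq h he,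
    rcLimit_false_eq_rcLimit_true_of_edgeDensity_eq hp hq⟩

/-- One edge suffices: `φ⁰_{p,q} = φ¹_{p,q}` iff `h⁰(p,q)(e₀) = h¹(p,q)(e₀)` at ONE edge `e₀` of `ℤ^d`
(the densities do not depend on the edge, (4.61)). [cite: Grimmett2006, Thm. (4.63) with (4.61)] -/
theorem rcLimit_false_eq_rcLimit_true_iff_of_mem_edgeSet {p q : ℝ} (hp : p ∈ Set.Icc (0 : ℝ) 1)
    (hq : 1 ≤ q) {e₀ : Sym2 (Site d)} (he₀ : e₀ ∈ (zdGraph d).edgeSet) :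
    rcLimit d false p q = rcLimit d true p q ↔ freeEdgeDensity d p q e₀ = wiredEdgeDensity d p q e₀ := by
  obtain ⟨i, -, -⟩ := exists_eq_map_add_of_mem_edgeSet he₀
  have hd : 0 < d := i.pos
  rw [rcLimit_false_eq_rcLimit_true_iff hp hq]
  refine ⟨fun h => h e₀ he₀, fun h e he => ?_⟩
  rw [freeEdgeDensity_eq_of_mem_edgeSet hp hq he he₀, wiredEdgeDensity_eq_of_mem_edgeSet hd hp hq he he₀, h]

/-! ### Thm. (4.60)/(4.63): `φ⁰_{p,q} = φ¹_{p,q}` except for at most countably many `p` -/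

/-- **Grimmett 2006, Thm. (4.63) with Thm. (4.60): the set of parameters `p ∈ [0,1]` at which the free and
wired infinite-volume random-cluster measures on `ℤ^d` differ is (at most) countable** (`q ≥ 1`, every
`d`). Proof: off the endpoints it is contained in the countable set of `p ∈ (0,1)` with
`h⁰(p,q)(e₀) < h¹(p,q)(e₀)` at a fixed edge `e₀` (`countable_setOf_freeEdgeDensity_lt`, the disjoint
intervals `(h⁰(p), h¹(p))`; in dimension `0` the set is empty). [cite: Grimmett2006, Thm. (4.63) and Thm. (4.60)] -/
theorem countable_setOf_rcLimit_false_ne_rcLimit_true {q : ℝ} (hq : 1 ≤ q) :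
    {p : ℝ | p ∈ Set.Icc (0 : ℝ) 1 ∧ rcLimit d false p q ≠ rcLimit d true p q}.Countable := by
  rcases Nat.eq_zero_or_pos d with hd | hd
  · convert Set.countable_empty
    refine Set.eq_empty_of_forall_notMem fun p hp => hp.2 (rcLimit_eq_false_of_eq_zero hd true p q).symm
  -- a reference edge
  set e₀ : Sym2 (Site d) := s(0, Pi.single ⟨0, hd⟩ 1) with he₀
  have he₀E : e₀ ∈ (zdGraph d).edgeSet := by
    rw [SimpleGraph.mem_edgeSet]
    exact (zdGraph_adj_iff _ _).2 ⟨⟨0, hd⟩, Or.inl (by rw [zero_add])⟩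
  have hbad := countable_setOf_freeEdgeDensity_lt hd hq he₀E
  refine (hbad.union (((Set.finite_singleton (1 : ℝ)).insert 0).countable)).mono fun p hp => ?_
  rcases hp with ⟨hpI, hne⟩
  by_cases h01 : p ∈ Set.Ioo (0 : ℝ) 1
  · refine Or.inl ⟨h01, lt_of_le_of_ne (freeEdgeDensity_le_wiredEdgeDensity hd hpI hq e₀) fun h => hne ?_⟩
    exact (rcLimit_false_eq_rcLimit_true_iff_of_mem_edgeSet hpI hq he₀E).2 h
  · refine Or.inr ?_
    rcases hpI.1.eq_or_lt with h0 | h0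
    · exact Or.inl h0.symm
    · rcases hpI.2.eq_or_lt with h1 | h1
      · exact Or.inr h1
      · exact absurd ⟨h0, h1⟩ h01

/-! ### Consequences: uniqueness of the random-cluster measure, and `θ⁰ = θ¹`, off a countable set -/

namespace FKGibbs

variable {p q : ℝ} {P : Measure (BondConfig (Site d))}

/-- **Every measure of the sandwich class equals `φ⁰_{p,q}` at a parameter of equal edge densities**
(Grimmett's `|W_{p,q}| = |R_{p,q}| = 1` in Thm. (4.63), read on the cell's class `FKGibbs`): (4.36) "⇐"
(`FKGibbs.eq_rcLimit_of_rcLimit_false_eq_true`) with its hypothesis discharged by Thm. (4.63).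
[cite: Grimmett2006, Thm. (4.63) with Thm. (4.34) eq. (4.36)] -/
theorem eq_rcLimit_of_edgeDensity_eq (hP : FKGibbs d p q P) (hp : p ∈ Set.Icc (0 : ℝ) 1) (hq : 1 ≤ q)
    (hgood : ∀ e ∈ (zdGraph d).edgeSet, freeEdgeDensity d p q e = wiredEdgeDensity d p q e) :
    P = rcLimit d false p q :=
  hP.eq_rcLimit_of_rcLimit_false_eq_true hp hq (rcLimit_false_eq_rcLimit_true_of_edgeDensity_eq hp hq hgood)

end FKGibbs

/-- At a parameter of equal edge densities the sandwich class `FKGibbs d p q` is EXACTLY `{φ⁰_{p,q}}`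
(`0 ≤ p ≤ 1`, `q ≥ 1`). [cite: Grimmett2006, Thm. (4.63) with Thm. (4.34) eq. (4.36)] -/
theorem fkGibbs_iff_eq_rcLimit_of_edgeDensity_eq {p q : ℝ} (hp : p ∈ Set.Icc (0 : ℝ) 1) (hq : 1 ≤ q)
    (hgood : ∀ e ∈ (zdGraph d).edgeSet, freeEdgeDensity d p q e = wiredEdgeDensity d p q e)
    (P : Measure (BondConfig (Site d))) : FKGibbs d p q P ↔ P = rcLimit d false p q :=
  ⟨fun hP => hP.eq_rcLimit_of_edgeDensity_eq hp hq hgood,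
    fun h => h ▸ (isBoxLimit_rcLimit false hp hq).fkGibbs hp hq⟩

/-- **Off a countable set of `p ∈ [0,1]` the random-cluster measure is unique**: the set of `p ∈ [0,1]`
at which some measure of the sandwich class `FKGibbs d p q` differs from `φ⁰_{p,q}` is countable (`q ≥ 1`,
every `d`) — Grimmett 2006, Thm. (4.63) "`|W_{p,q}| = |R_{p,q}| = 1` for `p ∉ 𝒟_q`" with (4.60).
[cite: Grimmett2006, Thm. (4.63) and Thm. (4.60)] -/
theorem countable_setOf_exists_fkGibbs_ne_rcLimit {q : ℝ} (hq : 1 ≤ q) :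
    {p : ℝ | p ∈ Set.Icc (0 : ℝ) 1 ∧
      ∃ P : Measure (BondConfig (Site d)), FKGibbs d p q P ∧ P ≠ rcLimit d false p q}.Countable := by
  refine (countable_setOf_rcLimit_false_ne_rcLimit_true (d := d) hq).mono fun p hp => ?_
  rcases hp with ⟨hpI, P, hP, hne⟩
  exact ⟨hpI, fun h => hne (hP.eq_rcLimit_of_rcLimit_false_eq_true hpI hq h)⟩

/-- **`φ⁰_{p,q} = φ¹_{p,q}` implies `θ⁰(p,q) = θ¹(p,q)`** (`0 ≤ p ≤ 1`, `q ≥ 1`): the two percolation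
probabilities are the masses of `{0 ↔ ∞}` under the two measures (FO-07, (5.1)).
[cite: Grimmett2006, §5.1 (5.1) and (5.3), p. 98] -/
theorem thetaFree_eq_thetaWired_of_rcLimit_false_eq_rcLimit_true {p q : ℝ} (hp : p ∈ Set.Icc (0 : ℝ) 1)
    (hq : 1 ≤ q) (h : rcLimit d false p q = rcLimit d true p q) : thetaFree d p q = thetaWired d p q := by
  rw [← rcLimit_false_real_percolatesAt hp hq, ← rcLimit_true_real_percolatesAt hp hq, h]

/-- **Grimmett 2006, §5.1, p. 98: "`θ⁰(p,q) = θ¹(p,q)` … except possibly for countably many `p`"** — the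
set of `p ∈ [0,1]` with `θ⁰(p,q) ≠ θ¹(p,q)` is countable (`q ≥ 1`, every `d`), being contained in the set
where `φ⁰_{p,q} ≠ φ¹_{p,q}`. [cite: Grimmett2006, §5.1 (5.3) p. 98 with Thm. (4.63)] -/
theorem countable_setOf_thetaFree_ne_thetaWired {q : ℝ} (hq : 1 ≤ q) :
    {p : ℝ | p ∈ Set.Icc (0 : ℝ) 1 ∧ thetaFree d p q ≠ thetaWired d p q}.Countable := by
  refine (countable_setOf_rcLimit_false_ne_rcLimit_true (d := d) hq).mono fun p hp => ?_
  exact ⟨hp.1, fun h => hp.2 (thetaFree_eq_thetaWired_of_rcLimit_false_eq_rcLimit_true hp.1 hq h)⟩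

/-- `φ⁰_{p,q} = φ¹_{p,q}` implies the cell's boundary-condition seam `FKUniqueAt d p q` (`θ⁰(p,q) = θ¹(p,q)`).
[cite: Grimmett2006, Thm. (5.16)(c) with Thm. (4.63)] -/
theorem fkUniqueAt_of_rcLimit_false_eq_rcLimit_true {p q : ℝ} (hp : p ∈ Set.Icc (0 : ℝ) 1) (hq : 1 ≤ q)
    (h : rcLimit d false p q = rcLimit d true p q) : FKUniqueAt d p q :=
  thetaFree_eq_thetaWired_of_rcLimit_false_eq_rcLimit_true hp hq h

/-- **The boundary-condition seam `θ⁰(p,q) = θ¹(p,q)` fails for at most countably many `p ∈ [0,1]`**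
(`q ≥ 1`, every `d`). [cite: Grimmett2006, Thm. (5.16)(c) with Thm. (4.63) and Thm. (4.60)] -/
theorem countable_setOf_not_fkUniqueAt {q : ℝ} (hq : 1 ≤ q) :
    {p : ℝ | p ∈ Set.Icc (0 : ℝ) 1 ∧ ¬ FKUniqueAt d p q}.Countable :=
  countable_setOf_thetaFree_ne_thetaWired hq

end Summit.CriticalPhenomena.PercolationContinuityZ3.Theorems.FK

end
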